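import Summits.QuantumAdvantage.QuantumAdvantage.Theorems.LinnikCubicClassGroupsDegreeOnePrimesEscapeCyclotomicLinnikSplit
import Summits.QuantumAdvantage.QuantumAdvantage.Theorems.LinnikCubicClassGroupsDegreeOnePrimesEscapeRayClassShortIntervalDegOne
import Summits.QuantumAdvantage.QuantumAdvantage.Theorems.LinnikCubicClassGroupsDegreeOnePrimesEscapeRayClassLowerBound
import Literature.NumberTheory.GaloisRepresentations.SplitsCompletelyCriteria
import Literature.NumberTheory.QuadraticFields.KroneckerSplitting
import HarnessLib

/-!
# Linnik's theorem for cosets of a congruence class group, XVII: primes `p ≡ a (mod q)` splitting completely in a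
# Galois number field — short intervals and a Siegel-free lower bound

Topic `Summits/QuantumAdvantage/QuantumAdvantage/Theorems`, cell B2b-1 (linnik-cubic), PART A (gen 25); helper toward
the crux `DegreeOnePrimesEscape` (stmt-QuantumAdvantage-11543) of route `LinnikCubicClassGroups`.  HONEST FRAMING: the
value of this file is a THEOREM (kernel-checked, GRH-free, Siegel-free) — NOT summit progress (the route still rests on
the hypothesis-type target `PureCubicClassNumberHard`).

The cyclotomic datum of file XII fed into the degree-one Hoheisel–Linnik theorem for cosets (file XV) and the
Siegel-free lower bound (file XVI).  For `K` of degree `n > 1`, `q ≥ 1`, an ideal `𝔞 ≠ 0` prime to `q`: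
* `exists_degOnePrime_absNorm_modEq_mem_Ioc` — for `x ≥ (|d_K| q)^{L(n)}` and `x^{1−δ(n)} ≤ h ≤ x` a prime `𝔭 ∌ q` of
  `K` whose norm is a rational prime `p ≡ N𝔞 (mod q)`, `p ∤ d_K`, with `x < p ≤ x + h`;
* `exists_prime_modEq_splittingType_eq_replicate_mem_Ioc` — **for `K/ℚ` Galois: a prime `p ≡ a (mod q)` (`a = N𝔞 mod
  q`), `p ∤ d_K`, SPLITTING COMPLETELY in `K`, in every such `(x, x+h]`** (Hoheisel–Linnik–Chebotarev for the
  compositum `K(ζ_q)`, uniform in `q`);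
* `primeCount_absNorm_modEq_ge` — **`#{𝔭 ∌ q : N𝔭 ≡ N𝔞 (mod q), N𝔭 ≤ x} ≥ c(n) x/((|d_K| q)^{C(n)} log x)`** for
  `x ≥ (|d_K| q)^{L(n)}` — the right order in `x` with a polynomial loss in `|d_K| q` in place of Siegel's ineffective
  constant;
* `exists_prime_modEq_jacobiSym_eq_one` — the quadratic case `n = 2` in classical language: an odd prime
  `p ≡ a (mod q)`, `p ∤ d_K`, with `(d_K/p) = 1` (two primes above `p`), `p ≤ (|d_K| q)^L`, `L` absolute.
References: [LagariasMontgomeryOdlyzko1979] §7; [Weiss1983] §6; [ThornerZaman2017] Thm 3.1.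
-/

noncomputable section

open Complex Real Set Filter Topology NumberField IsDedekindDomain
open scoped NumberField nonZeroDivisors

namespace Summit.QuantumAdvantage.QuantumAdvantage.Theorems.DegreeOnePrimesEscape

open Literature.NumberTheory.LFunctions Literature.NumberTheory.LFunctions.NumberField
  Literature.NumberTheory.LFunctions.AbelianDensity Literature.NumberTheory.GaloisRepresentations
  Literature.NumberTheory.NumberFields
open scoped Classical

/-! ### Short intervals: primes `p ≡ a (mod q)` in `(x, x+h]` splitting completely in a Galois field -/

/-- **Degree-one primes with `N𝔭 ≡ N𝔞 (mod q)` in short intervals**: for `n > 1` there are `δ = δ(n) > 0`,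
`L = L(n) > 0` such that for every number field `K` of degree `n`, every `q ≥ 1`, every ideal `𝔞 ≠ 0` prime to `q`,
every `x ≥ (|d_K| q)^L` and `x^{1−δ} ≤ h ≤ x` there is a prime `𝔭 ∌ q` of `K` whose norm is a rational prime
`p ≡ N𝔞 (mod q)`, `p ∤ d_K`, with `x < p ≤ x + h` (file XV for the cyclotomic datum of file XII).
[cite: LagariasMontgomeryOdlyzko1979, §7] [cite: Weiss1983, §6] -/
theorem exists_degOnePrime_absNorm_modEq_mem_Ioc (n : ℕ) (hn : 1 < n) :
    ∃ δ L : ℝ, 0 < δ ∧ 0 < L ∧ ∀ (K : Type) [Field K] [NumberField K], Module.finrank ℚ K = n →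
    ∀ q : ℕ, q ≠ 0 → ∀ I : Ideal (𝓞 K), I ≠ ⊥ → IsCoprime I (Ideal.span {(q : 𝓞 K)}) →
      ∀ x h : ℝ, (|(NumberField.discr K : ℝ)| * q) ^ L ≤ x → x ^ (1 - δ) ≤ h → h ≤ x →
      ∃ v : HeightOneSpectrum (𝓞 K), (q : 𝓞 K) ∉ v.asIdeal ∧ (Ideal.absNorm v.asIdeal).Prime ∧
        Ideal.absNorm v.asIdeal ≡ Ideal.absNorm I [MOD q] ∧
        ¬ ((Ideal.absNorm v.asIdeal : ℕ) : ℤ) ∣ NumberField.discr K ∧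
        x < (Ideal.absNorm v.asIdeal : ℝ) ∧ (Ideal.absNorm v.asIdeal : ℝ) ≤ x + h := by
  obtain ⟨δ, L, hδ, hL, hF⟩ := exists_degOnePrime_fiber_absNorm_mem_Ioc n hn
  refine ⟨δ, max (((n ^ 2 + 1 : ℕ) : ℝ) * L) 1, hδ, by positivity, fun K _ _ hKn q hq0 I hI hcop x h hx hhx hhx' ↦ ?_⟩
  haveI : NeZero q := ⟨hq0⟩
  set N : Type := CyclotomicField q K
  haveI := isGalois_of_isCyclotomicExtension K N q
  have hK : 1 < Module.finrank ℚ K := by rw [hKn]; exact hn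
  set 𝔪 : Ideal (𝓞 K) := Ideal.span {(q : 𝓞 K)} with h𝔪def
  have h𝔪 : 𝔪 ≠ ⊥ := span_natCast_ne_bot q
  set D : ℕ := (NumberField.discr K).natAbs with hDdef
  have hD0 : D ≠ 0 := Int.natAbs_ne_zero.mpr (NumberField.discr_ne_zero K)
  have hDR : ((D : ℕ) : ℝ) = |(NumberField.discr K : ℝ)| := by
    rw [hDdef, ← Int.cast_natCast (R := ℝ), Int.natCast_natAbs, Int.cast_abs]
  have hD1 : (1 : ℝ) ≤ |(NumberField.discr K : ℝ)| := by
    rw [← hDR]; exact_mod_cast Nat.one_le_iff_ne_zero.mpr hD0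
  have hq1 : (1 : ℝ) ≤ q := by exact_mod_cast Nat.one_le_iff_ne_zero.mpr hq0
  have hb1 : (1 : ℝ) ≤ |(NumberField.discr K : ℝ)| * q := by nlinarith
  have hxR : rayCondQ K 𝔪 ^ L ≤ x := by
    have h1 := rayCondQ_span_natCast_rpow_le (K := K) q hK hL.le
    rw [hKn] at h1
    exact h1.trans ((Real.rpow_le_rpow_of_exponent_le hb1 (le_max_left _ _)).trans hx)
  have hxD : |(NumberField.discr K : ℝ)| ≤ x := by
    have h1 := Real.rpow_le_rpow_of_exponent_le hb1 (le_max_right (((n ^ 2 + 1 : ℕ) : ℝ) * L) 1)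
    rw [Real.rpow_one] at h1
    nlinarith [h1.trans hx]
  set σ₀ : (cycloChar K N q).range := artinSymbol (frobChar K N q) I with hσ₀
  have hσ₀val : ((σ₀ : (ZMod q)ˣ) : ZMod q) = (Ideal.absNorm I : ZMod q) :=
    val_artinSymbol_frobChar K N q hI (natCast_not_mem_of_dvd_of_isCoprime q hcop)
  obtain ⟨v, hmv, hfv, hprime, hlo, hhi⟩ := hF K hKn (cycloChar K N q).range 𝔪 (frobChar K N q) h𝔪
    (artinKillsRay_frobChar K N q le_rfl) (fun χ hχ ↦ frobChar_nonprincipal q h𝔪 χ hχ)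
    (natCard_range_cycloChar_le q hK) x h hxR hhx hhx' σ₀
  have hm : (q : 𝓞 K) ∉ v.asIdeal := by rwa [h𝔪def, Ideal.span_singleton_le_iff_mem] at hmv
  refine ⟨v, hm, hprime, ?_, fun hdvd ↦ ?_, hlo, hhi⟩
  · have h1 : ((Ideal.absNorm v.asIdeal : ℕ) : ZMod q) = ((σ₀ : (ZMod q)ˣ) : ZMod q) := by
      rw [← val_cycloChar_galFrob K N q v hm, ← coe_frobChar, hfv]
    rw [hσ₀val] at h1
    exact (ZMod.natCast_eq_natCast_iff _ _ _).mp h1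
  · -- `p ∣ d_K` forces `p ≤ |d_K| ≤ x < p`
    have h1 : Ideal.absNorm v.asIdeal ∣ D := by
      have h0 : ((Ideal.absNorm v.asIdeal : ℕ) : ℤ) ∣ (D : ℤ) := by rw [hDdef, Int.dvd_natAbs]; exact hdvd
      exact Int.natCast_dvd_natCast.mp h0
    have h2 : (Ideal.absNorm v.asIdeal : ℝ) ≤ ((D : ℕ) : ℝ) := by
      exact_mod_cast Nat.le_of_dvd (Nat.pos_of_ne_zero hD0) h1
    rw [hDR] at h2
    linarith

/-- **Primes `p ≡ a (mod q)` splitting completely in a Galois number field, in short intervals**: for `n > 1` there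
are `δ = δ(n) > 0`, `L = L(n) > 0` such that for every Galois number field `K/ℚ` of degree `n`, every `q ≥ 1`, every
residue `a = N𝔞 mod q` of an ideal `𝔞 ≠ 0` prime to `q`, every `x ≥ (|d_K| q)^L` and `x^{1−δ} ≤ h ≤ x` there is a
prime `p ≡ a (mod q)`, `p ∤ d_K`, splitting completely in `K`, with `x < p ≤ x + h`.
[cite: LagariasMontgomeryOdlyzko1979, §7] [cite: Weiss1983, §6] -/
theorem exists_prime_modEq_splittingType_eq_replicate_mem_Ioc (n : ℕ) (hn : 1 < n) :
    ∃ δ L : ℝ, 0 < δ ∧ 0 < L ∧ ∀ (K : Type) [Field K] [NumberField K] [IsGalois ℚ K], Module.finrank ℚ K = n →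
    ∀ q : ℕ, q ≠ 0 → ∀ I : Ideal (𝓞 K), I ≠ ⊥ → IsCoprime I (Ideal.span {(q : 𝓞 K)}) →
      ∀ x h : ℝ, (|(NumberField.discr K : ℝ)| * q) ^ L ≤ x → x ^ (1 - δ) ≤ h → h ≤ x →
      ∃ p : ℕ, p.Prime ∧ p ≡ Ideal.absNorm I [MOD q] ∧ ¬ ((p : ℤ) ∣ NumberField.discr K) ∧
        splittingType K p = Multiset.replicate n 1 ∧ x < (p : ℝ) ∧ (p : ℝ) ≤ x + h := by
  obtain ⟨δ, L, hδ, hL, h⟩ := exists_degOnePrime_absNorm_modEq_mem_Ioc n hn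
  refine ⟨δ, L, hδ, hL, fun K _ _ _ hKn q hq0 I hI hcop x h' hx hhx hhx' ↦ ?_⟩
  obtain ⟨v, -, hprime, hres, hd, hlo, hhi⟩ := h K hKn q hq0 I hI hcop x h' hx hhx hhx'
  refine ⟨Ideal.absNorm v.asIdeal, hprime, hres, hd, ?_, hlo, hhi⟩
  rw [← hKn]
  exact splittingType_eq_replicate_one_of_prime_absNorm v hprime hd

/-! ### A Siegel-free lower bound for the primes with `N𝔭 ≡ a (mod m)` -/

/-- **`#{𝔭 ∌ m : N𝔭 ≡ N𝔞 (mod m), N𝔭 ≤ x} ≥ c(n) x / ((|d_K| m)^{C(n)} log x)` for all `x ≥ (|d_K| m)^{L(n)}`**, for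
every number field `K` of degree `n > 1`, every `m ≥ 1` and every ideal `𝔞 ≠ 0` prime to `m` — a lower bound of the
right order in `x`, with a polynomial loss in `|d_K| m` in place of Siegel's ineffective constant (file XVI for the
cyclotomic datum). [cite: Weiss1983, §6] [cite: ThornerZaman2017, Theorem 3.1] -/
theorem primeCount_absNorm_modEq_ge (n : ℕ) (hn : 1 < n) :
    ∃ L C c : ℝ, 0 < L ∧ 0 < C ∧ 0 < c ∧ ∀ (K : Type) [Field K] [NumberField K], Module.finrank ℚ K = n →
    ∀ m : ℕ, m ≠ 0 → ∀ I : Ideal (𝓞 K), I ≠ ⊥ → IsCoprime I (Ideal.span {(m : 𝓞 K)}) →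
      ∀ x : ℝ, (|(NumberField.discr K : ℝ)| * m) ^ L ≤ x →
        c * x / ((|(NumberField.discr K : ℝ)| * m) ^ C * Real.log x) ≤
          (({v : HeightOneSpectrum (𝓞 K) | (m : 𝓞 K) ∉ v.asIdeal ∧ Ideal.absNorm v.asIdeal ≡ Ideal.absNorm I [MOD m] ∧
              (Ideal.absNorm v.asIdeal : ℝ) ≤ x}.ncard : ℕ) : ℝ) := by
  obtain ⟨L, c, hL, hc, hmain⟩ := fiberPrimeCount_ge n hn
  refine ⟨max (((n ^ 2 + 1 : ℕ) : ℝ) * L) 1, ((n ^ 2 + 1 : ℕ) : ℝ) * 12, c, by positivity, by positivity, hc,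
    fun K _ _ hKn m hm0 I hI hcop x hx ↦ ?_⟩
  haveI : NeZero m := ⟨hm0⟩
  set N : Type := CyclotomicField m K
  haveI := isGalois_of_isCyclotomicExtension K N m
  have hK : 1 < Module.finrank ℚ K := by rw [hKn]; exact hn
  set 𝔪 : Ideal (𝓞 K) := Ideal.span {(m : 𝓞 K)} with h𝔪def
  have h𝔪 : 𝔪 ≠ ⊥ := span_natCast_ne_bot m
  set R : ℝ := rayCondQ K 𝔪 with hR
  have hR12 : (12 : ℝ) ≤ R := twelve_le_rayCondQ hK h𝔪
  have hR1 : (1 : ℝ) ≤ R := by linarith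
  have hR0 : (0 : ℝ) < R := by linarith
  set B : ℝ := |(NumberField.discr K : ℝ)| * m with hBdef
  have hB2 : (2 : ℝ) < B := by
    have hD2 : 2 < |(NumberField.discr K : ℝ)| := by
      have h := NumberField.abs_discr_gt_two hK
      rw [← Int.cast_abs]; exact_mod_cast h
    have hm1 : (1 : ℝ) ≤ m := by exact_mod_cast NeZero.one_le
    rw [hBdef]; nlinarith
  have hB1 : (1 : ℝ) ≤ B := by linarith
  have hRB : R ≤ B ^ (n ^ 2 + 1) := by
    have := rayCondQ_span_natCast_le (K := K) m hK
    rw [hKn] at this; exact this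
  have hxR : R ^ L ≤ x := by
    have h1 := rayCondQ_span_natCast_rpow_le (K := K) m hK hL.le
    rw [hKn] at h1
    exact h1.trans ((Real.rpow_le_rpow_of_exponent_le hB1 (le_max_left _ _)).trans hx)
  have hxB : B ≤ x := by
    have h1 := Real.rpow_le_rpow_of_exponent_le hB1 (le_max_right (((n ^ 2 + 1 : ℕ) : ℝ) * L) 1)
    rw [Real.rpow_one] at h1; exact h1.trans hx
  have hx0 : 0 < x := by linarith
  have hlogx : 0 < Real.log x := Real.log_pos (by linarith)
  -- `σ` with `χ_m(σ) = N𝔞 mod m`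
  set τ₀ : (cycloChar K N m).range := artinSymbol (frobChar K N m) I with hτ₀
  have hτ₀val : ((τ₀ : (ZMod m)ˣ) : ZMod m) = (Ideal.absNorm I : ZMod m) :=
    val_artinSymbol_frobChar K N m hI (natCast_not_mem_of_dvd_of_isCoprime m hcop)
  obtain ⟨σ, hσ⟩ := τ₀.2
  have hσval : ((cycloChar K N m σ : (ZMod m)ˣ) : ZMod m) = (Ideal.absNorm I : ZMod m) := by rw [hσ, hτ₀val]
  have hset : {v : HeightOneSpectrum (𝓞 K) | (m : 𝓞 K) ∉ v.asIdeal ∧ Ideal.absNorm v.asIdeal ≡ Ideal.absNorm I [MOD m] ∧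
      (Ideal.absNorm v.asIdeal : ℝ) ≤ x} =
      {v : HeightOneSpectrum (𝓞 K) | ¬ 𝔪 ≤ v.asIdeal ∧ frobChar K N m v = (cycloChar K N m).rangeRestrict σ ∧
        (Ideal.absNorm v.asIdeal : ℝ) ≤ x} := by
    ext v
    simp only [Set.mem_setOf_eq, h𝔪def, not_span_le_iff, frobChar_eq_rangeRestrict_iff]
    constructor
    · rintro ⟨hm, hres, hle⟩
      refine ⟨hm, ?_, hle⟩
      apply cycloChar_injective K N m
      apply Units.ext
      rw [hσval]; exact (natCast_absNorm_eq_iff (N := N) m hm _).mp hres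
    · rintro ⟨hm, hF, hle⟩
      refine ⟨hm, ?_, hle⟩
      rw [natCast_absNorm_eq_iff (N := N) m hm, hF, hσval]
  rw [hset]
  refine le_trans ?_ (hmain K hKn (cycloChar K N m).range 𝔪 (frobChar K N m) h𝔪
    (artinKillsRay_frobChar K N m le_rfl) (fun χ hχ ↦ frobChar_nonprincipal m h𝔪 χ hχ)
    (natCard_range_cycloChar_le m hK) x hxR ((cycloChar K N m).rangeRestrict σ))
  -- constants: `|H| ≤ R⁴ = R^{-8} R^{12} ≤ R^{-8} B^{12(n²+1)}`
  have hH : (Nat.card (cycloChar K N m).range : ℝ) ≤ R ^ (4 : ℕ) := natCard_range_cycloChar_le m hK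
  have hH0 : (0 : ℝ) < Nat.card (cycloChar K N m).range := by
    haveI : Finite (cycloChar K N m).range := inferInstance
    exact_mod_cast Nat.card_pos
  have hR8 : R ^ (-(8 : ℝ)) * R ^ (12 : ℕ) = R ^ (4 : ℕ) := by
    rw [show (R ^ (12 : ℕ) : ℝ) = R ^ (12 : ℝ) from (Real.rpow_natCast R 12).symm, ← Real.rpow_add hR0,
      show (R ^ (4 : ℕ) : ℝ) = R ^ (4 : ℝ) from (Real.rpow_natCast R 4).symm]
    norm_num
  have hBC : R ^ (12 : ℕ) ≤ B ^ (((n ^ 2 + 1 : ℕ) : ℝ) * 12) := by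
    rw [Real.rpow_mul (by linarith), Real.rpow_natCast,
      show ((B ^ (n ^ 2 + 1)) ^ (12 : ℝ) : ℝ) = (B ^ (n ^ 2 + 1)) ^ (12 : ℕ) from by
        rw [show (12 : ℝ) = ((12 : ℕ) : ℝ) by norm_num, Real.rpow_natCast]]
    exact pow_le_pow_left₀ hR0.le hRB 12
  have hkey : (Nat.card (cycloChar K N m).range : ℝ) ≤ R ^ (-(8 : ℝ)) * B ^ (((n ^ 2 + 1 : ℕ) : ℝ) * 12) := by
    calc (Nat.card (cycloChar K N m).range : ℝ) ≤ R ^ (4 : ℕ) := hH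
      _ = R ^ (-(8 : ℝ)) * R ^ (12 : ℕ) := hR8.symm
      _ ≤ R ^ (-(8 : ℝ)) * B ^ (((n ^ 2 + 1 : ℕ) : ℝ) * 12) :=
          mul_le_mul_of_nonneg_left hBC (Real.rpow_nonneg hR0.le _)
  rw [div_le_div_iff₀ (by positivity) (by positivity)]
  calc c * x * ((Nat.card (cycloChar K N m).range : ℝ) * Real.log x)
      ≤ c * x * (R ^ (-(8 : ℝ)) * B ^ (((n ^ 2 + 1 : ℕ) : ℝ) * 12) * Real.log x) := by gcongr
    _ = c * R ^ (-(8 : ℝ)) * x * (B ^ (((n ^ 2 + 1 : ℕ) : ℝ) * 12) * Real.log x) := by ring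

/-! ### The quadratic case: Linnik with a quadratic residue condition -/

/-- **Linnik's theorem for the primes `p ≡ a (mod q)` with `(d_K/p) = 1`**: there is an absolute `L > 0` such that for
every quadratic field `K` (discriminant `d_K`), every `q ≥ 1` and every residue `a = N𝔞 mod q` of an ideal `𝔞 ≠ 0` of
`𝓞 K` prime to `q`, there is an odd prime `p ≡ a (mod q)`, `p ∤ d_K`, that splits in `K` — two primes of `𝓞 K` above
`p`, equivalently Jacobi symbol `(d_K/p) = 1` (tree `ncard_primesOver_eq_two_iff_jacobiSym`) — with `p ≤ (|d_K| q)^L`.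
[cite: Weiss1983, Theorem 6.4] [cite: ThornerZaman2017, Theorem 1.1] -/
theorem exists_prime_modEq_jacobiSym_eq_one :
    ∃ L : ℝ, 0 < L ∧ ∀ (K : Type) [Field K] [NumberField K], Module.finrank ℚ K = 2 →
    ∀ q : ℕ, q ≠ 0 → ∀ I : Ideal (𝓞 K), I ≠ ⊥ → IsCoprime I (Ideal.span {(q : 𝓞 K)}) →
      ∃ p : ℕ, p.Prime ∧ p ≠ 2 ∧ p ≡ Ideal.absNorm I [MOD q] ∧ ¬ ((p : ℤ) ∣ NumberField.discr K) ∧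
        ((Ideal.span {(p : ℤ)}).primesOver (𝓞 K)).ncard = 2 ∧ jacobiSym (NumberField.discr K) p = 1 ∧
        (p : ℝ) ≤ (|(NumberField.discr K : ℝ)| * q) ^ L := by
  obtain ⟨δ, L, hδ, hL, h⟩ := exists_degOnePrime_absNorm_modEq_mem_Ioc 2 (by norm_num)
  refine ⟨max L 1 + 1, by positivity, fun K _ _ hK2 q hq0 I hI hcop ↦ ?_⟩
  have hK : 1 < Module.finrank ℚ K := by rw [hK2]; norm_num
  haveI : Algebra.IsQuadraticExtension ℚ K := { finrank_eq_two' := hK2 }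
  haveI : IsGalois ℚ K := inferInstance
  set B : ℝ := |(NumberField.discr K : ℝ)| * q with hBdef
  have hB2 : (2 : ℝ) < B := by
    have hD2 : 2 < |(NumberField.discr K : ℝ)| := by
      have h := NumberField.abs_discr_gt_two hK
      rw [← Int.cast_abs]; exact_mod_cast h
    have hq1 : (1 : ℝ) ≤ q := by exact_mod_cast Nat.one_le_iff_ne_zero.mpr hq0
    rw [hBdef]; nlinarith
  have hB1 : (1 : ℝ) ≤ B := by linarith
  set x : ℝ := B ^ (max L 1) with hxdef
  have hxL : B ^ L ≤ x := Real.rpow_le_rpow_of_exponent_le hB1 (le_max_left L 1)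
  have hxB : B ≤ x := by
    have := Real.rpow_le_rpow_of_exponent_le hB1 (le_max_right L 1)
    rwa [Real.rpow_one] at this
  have hx1 : (1 : ℝ) ≤ x := by linarith
  have hhx : x ^ (1 - δ) ≤ x := by
    have := Real.rpow_le_rpow_of_exponent_le hx1 (by linarith : 1 - δ ≤ 1)
    rwa [Real.rpow_one] at this
  obtain ⟨v, -, hprime, hres, hd, hlo, hhi⟩ := h K hK2 q hq0 I hI hcop x x hxL hhx le_rfl
  set p : ℕ := Ideal.absNorm v.asIdeal with hpdef
  have hp2 : p ≠ 2 := by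
    intro h2
    have : (p : ℝ) = 2 := by exact_mod_cast h2
    linarith
  -- unramified over `ℤ` at `v` since `p ∤ d_K`
  haveI := v.isPrime
  have hunr : Algebra.IsUnramifiedAt ℤ v.asIdeal := by
    have hpZ : Prime (p : ℤ) := Nat.prime_iff_prime_int.mp hprime
    have hmem : ((p : ℤ) : 𝓞 K) ∈ v.asIdeal := by
      rw [Int.cast_natCast]; exact Ideal.absNorm_mem v.asIdeal
    exact (NumberField.not_dvd_discr_iff_forall_mem K (𝓞 K) hpZ).mp hd v.asIdeal v.isPrime hmem
  have hsplit : ((Ideal.span {(p : ℤ)}).primesOver (𝓞 K)).ncard = 2 := by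
    rw [← hK2]
    exact ncard_primesOver_absNorm_eq_finrank_of_prime_absNorm (M := K) v hprime hunr
  refine ⟨p, hprime, hp2, hres, hd, hsplit,
    (Literature.NumberTheory.QuadraticFields.Quadratic.ncard_primesOver_eq_two_iff_jacobiSym hK2 hprime hp2).mp hsplit,
    ?_⟩
  -- `p ≤ 2x = 2 B^{max L 1} ≤ B^{max L 1 + 1}`
  have hB0 : 0 < B := by linarith
  calc (p : ℝ) ≤ x + x := hhi
    _ = 2 * x := by ring
    _ ≤ B * x := mul_le_mul_of_nonneg_right hB2.le (by linarith)
    _ = B ^ (max L 1 + 1) := by rw [Real.rpow_add hB0, Real.rpow_one, mul_comm]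

end Summit.QuantumAdvantage.QuantumAdvantage.Theorems.DegreeOnePrimesEscape

end
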